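import Summits.CriticalPhenomena.PercolationContinuityZ3.Theorems.PercNearOneGluingNoHeavyLowerTailAntitheticEarTools
import Summits.CriticalPhenomena.PercolationContinuityZ3.Theorems.PercNearOneGluingNoHeavyLowerTailAntitheticBoxes
import Summits.CriticalPhenomena.PercolationContinuityZ3.Theorems.PercNearOneGluingNoHeavyLowerTailAntitheticBlockTools
import HarnessLib

/-!
# `NoHeavyLowerTail` (stmt-CriticalPhenomena-4575) — antithetic cluster pairs: BOX PARTITIONS SURVIVE GLUING ANYTHING AT THE SOURCE
# (closure lemma (P2) of HOME/MEMO-gen63.md §6; prim-hp-2 gen 63)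

Support file (`--supports stmt-CriticalPhenomena-4575`, hull-port prover `prim-hp-2`, gen 63).  No definitions, no named facts, no sorries;
standard axioms.  Notation of …AntitheticBoxes (`X T = openCluster (T ∩ E) s`, `Y T = openCluster (Tᶜ ∩ E) s`, boxes `(Fix c, N c)`).

**`Antithetic.Box.boxes_glue_source`** (∃-transformer).  Let `E₁`, `E₂` be edge sets meeting only at the source `s` (every vertex common
to a pair of `E₁` and a pair of `E₂` is `s`) and let `P` be a vertex not on `E₂` (unless `P = s`).  Then a partition of `{P ∈ X_{E₁}}` into
red-dominated boxes with fixed pairs inside `E₁` (cover / inside / domination) is one of `{P ∈ X_{E₁ ∪ E₂}}` — the SAME boxes, the pairs of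
`E₂` free.  Reason: a red or blue path from `s` that enters `E₂` can only come back through `s`, so `X_{E₁∪E₂} ∩ V(E₁) = X_{E₁}` and
`Y_{E₁∪E₂} = Y_{E₁} ∪ Y_{E₂}`; on `E₂` every (non-loop) pair is free, so the antipode is the complement there and `Y_{E₂} T' = X_{E₂} T`.
Consequence (with the ⊕-HANDLE THEOREM `Pendant.handle_vertex_sum_nonneg_of_boxes`): CONJECTURE Δ2 for `(K₁ ∪_s K₂)` + handle(P,Q) whenever
`(K₁, s, P)` is box-decomposable — `K₂` ARBITRARY (bouquets at `s`, θ-graphs or cycles with anything glued at the source, …).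
[cite: VandenbergHaggstromKahn2005, §1 p. 3 (open cluster `C_s`)]
-/

noncomputable section

namespace Summit.CriticalPhenomena.PercolationContinuityZ3.Theorems

open Literature.Probability.Percolation
open scoped Classical

namespace Antithetic

namespace Box

variable {V : Type*} {E₁ E₂ : Set (Sym2 V)} {s P : V}

/-- A vertex of the cluster of `s` in `G ∩ E₁`, other than `s`, lies on a pair of `E₁`. -/
theorem mem_pair_of_mem_cluster {G : Set (Sym2 V)} {x : V} (hx : x ∈ openCluster (G ∩ E₁) s) (hxs : x ≠ s) :
    ∃ e ∈ E₁, x ∈ e := by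
  obtain ⟨w, hw, -⟩ := Glue.exists_pair_of_reachable (G ∩ E₁) hxs (SimpleGraph.Reachable.symm hx)
  exact ⟨_, hw.2, Sym2.mem_mk_left _ _⟩

/-- **Gluing at the source does not change the red cluster on the first side.**  If `E₁`, `E₂` meet only at `s` and `P` is not on `E₂`
(unless `P = s`), then `P ∈ X_{E₁ ∪ E₂} T ↔ P ∈ X_{E₁} T`. [this work] -/
theorem mem_X_glue_iff (hsep : ∀ e₁ ∈ E₁, ∀ e₂ ∈ E₂, ∀ x : V, x ∈ e₁ → x ∈ e₂ → x = s) (hP : ∀ e ∈ E₂, P ∈ e → P = s)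
    (T : Set (Sym2 V)) : P ∈ openCluster (T ∩ (E₁ ∪ E₂)) s ↔ P ∈ openCluster (T ∩ E₁) s := by
  constructor
  · intro h
    -- the closed set: the `E₁`-cluster of `s` together with all vertices of `E₂`
    have hcl := cluster_subset_of_closed (T ∩ (E₁ ∪ E₂)) s (openCluster (T ∩ E₁) s ∪ {x | ∃ e ∈ E₂, x ∈ e})
      (Or.inl (mem_openCluster_self _ _)) (fun a b ha hab => ?_) h
    · rcases hcl with h1 | ⟨e, he, hPe⟩
      · exact h1
      · rw [hP e he hPe]; exact mem_openCluster_self _ _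
    · rcases hab.2 with h1 | h2
      · rcases ha with ha | ⟨e, he, hae⟩
        · exact Or.inl (Freeze.mem_cluster_of_edge ha ⟨hab.1, h1⟩)
        · have has : a = s := hsep _ h1 e he a (Sym2.mem_mk_left _ _) hae
          subst has
          exact Or.inl (Freeze.mem_cluster_of_edge (mem_openCluster_self _ _) ⟨hab.1, h1⟩)
      · exact Or.inr ⟨_, h2, Sym2.mem_mk_right _ _⟩
  · exact fun h => Freeze.openCluster_mono (Set.inter_subset_inter_right _ Set.subset_union_left) _ h

/-- **The cluster of `s` in a source-glued union splits.**  If `E₁`, `E₂` meet only at `s` then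
`openCluster (G ∩ (E₁ ∪ E₂)) s ⊆ openCluster (G ∩ E₁) s ∪ openCluster (G ∩ E₂) s`. [this work] -/
theorem cluster_glue_subset (hsep : ∀ e₁ ∈ E₁, ∀ e₂ ∈ E₂, ∀ x : V, x ∈ e₁ → x ∈ e₂ → x = s) (G : Set (Sym2 V)) :
    openCluster (G ∩ (E₁ ∪ E₂)) s ⊆ openCluster (G ∩ E₁) s ∪ openCluster (G ∩ E₂) s := by
  refine cluster_subset_of_closed (G ∩ (E₁ ∪ E₂)) s _ (Or.inl (mem_openCluster_self _ _)) fun a b ha hab => ?_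
  rcases hab.2 with h1 | h2
  · rcases ha with ha | ha
    · exact Or.inl (Freeze.mem_cluster_of_edge ha ⟨hab.1, h1⟩)
    · by_cases has : a = s
      · subst has; exact Or.inl (Freeze.mem_cluster_of_edge (mem_openCluster_self _ _) ⟨hab.1, h1⟩)
      · obtain ⟨e, he, hae⟩ := mem_pair_of_mem_cluster ha has
        exact absurd (hsep _ h1 e he a (Sym2.mem_mk_left _ _) hae) has
  · rcases ha with ha | ha
    · by_cases has : a = s
      · subst has; exact Or.inr (Freeze.mem_cluster_of_edge (mem_openCluster_self _ _) ⟨hab.1, h2⟩)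
      · obtain ⟨e, he, hae⟩ := mem_pair_of_mem_cluster ha has
        exact absurd (hsep e he _ h2 a hae (Sym2.mem_mk_left _ _)) has
    · exact Or.inr (Freeze.mem_cluster_of_edge ha ⟨hab.1, h2⟩)

/-- **Box partitions survive gluing anything at the source** (∃-transformer).  `E₁`, `E₂` meet only at `s`; `P` is not on `E₂` unless
`P = s`; boxes `(Fix c, N c)`, `Fix c ⊆ E₁`, partition `{P ∈ X_{E₁}}` into red-dominated boxes.  Then the same boxes partition
`{P ∈ X_{E₁ ∪ E₂}}` into red-dominated boxes (cover / inside / domination for `E₁ ∪ E₂`; uniqueness is unchanged). [this work] -/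
theorem boxes_glue_source (hsep : ∀ e₁ ∈ E₁, ∀ e₂ ∈ E₂, ∀ x : V, x ∈ e₁ → x ∈ e₂ → x = s) (hP : ∀ e ∈ E₂, P ∈ e → P = s)
    {C : Type*} (Fix N : C → Set (Sym2 V)) (hFixE : ∀ c, Fix c ⊆ E₁)
    (hcover : ∀ T : Set (Sym2 V), P ∈ openCluster (T ∩ E₁) s → ∃ c, ∀ e ∈ Fix c, (e ∈ T ↔ e ∈ N c))
    (hinside : ∀ c (T : Set (Sym2 V)), (∀ e ∈ Fix c, (e ∈ T ↔ e ∈ N c)) → P ∈ openCluster (T ∩ E₁) s)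
    (hdom : ∀ c (T T' : Set (Sym2 V)), (∀ e ∈ Fix c, (e ∈ T ↔ e ∈ N c)) → (∀ e ∈ Fix c, (e ∈ T' ↔ e ∈ N c)) →
      (∀ e ∉ Fix c, (e ∈ T' ↔ e ∉ T)) → openCluster (T'ᶜ ∩ E₁) s ⊆ openCluster (T ∩ E₁) s) :
    (∀ c, Fix c ⊆ E₁ ∪ E₂) ∧
    (∀ T : Set (Sym2 V), P ∈ openCluster (T ∩ (E₁ ∪ E₂)) s → ∃ c, ∀ e ∈ Fix c, (e ∈ T ↔ e ∈ N c)) ∧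
    (∀ c (T : Set (Sym2 V)), (∀ e ∈ Fix c, (e ∈ T ↔ e ∈ N c)) → P ∈ openCluster (T ∩ (E₁ ∪ E₂)) s) ∧
    (∀ c (T T' : Set (Sym2 V)), (∀ e ∈ Fix c, (e ∈ T ↔ e ∈ N c)) → (∀ e ∈ Fix c, (e ∈ T' ↔ e ∈ N c)) →
      (∀ e ∉ Fix c, (e ∈ T' ↔ e ∉ T)) → openCluster (T'ᶜ ∩ (E₁ ∪ E₂)) s ⊆ openCluster (T ∩ (E₁ ∪ E₂)) s) := by
  refine ⟨fun c => (hFixE c).trans Set.subset_union_left, fun T hT => hcover T ((mem_X_glue_iff hsep hP T).1 hT),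
    fun c T hT => (mem_X_glue_iff hsep hP T).2 (hinside c T hT), fun c T T' hT hT' hflip y hy => ?_⟩
  rcases cluster_glue_subset hsep T'ᶜ hy with h1 | h2
  · exact Freeze.openCluster_mono (Set.inter_subset_inter_right _ Set.subset_union_left) _ (hdom c T T' hT hT' hflip h1)
  · -- on `E₂` every non-loop pair is free: a blue pair of `T'` there is red in `T`
    refine SimpleGraph.Reachable.mono (fun a b hab => ?_) h2
    rw [openGraph_adj] at hab ⊢
    obtain ⟨⟨hT'c, h2e⟩, hne⟩ := hab
    have hnot1 : s(a, b) ∉ E₁ := by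
      intro h1
      have ha := hsep _ h1 _ h2e a (Sym2.mem_mk_left _ _) (Sym2.mem_mk_left _ _)
      have hb := hsep _ h1 _ h2e b (Sym2.mem_mk_right _ _) (Sym2.mem_mk_right _ _)
      exact hne (ha.trans hb.symm)
    have hred : s(a, b) ∈ T := by
      by_contra h
      exact hT'c ((hflip _ fun hF => hnot1 (hFixE c hF)).2 h)
    exact ⟨⟨hred, Or.inr h2e⟩, hne⟩

end Box

end Antithetic

end Summit.CriticalPhenomena.PercolationContinuityZ3.Theorems
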